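import Mathlib
import HarnessLib
import Summits.ValiantsHypothesis.ValiantsHypothesis.Theorems.MonotoneRestorationOrbitRestorationQPSharpResidueCatalecticant
import Summits.ValiantsHypothesis.ValiantsHypothesis.Theorems.MonotoneRestorationOrbitRestorationQPAffineSubst

/-!
# The affine set-multilinear strata UP TO EQUIVARIANT AFFINE CHANGES OF VARIABLES, per level, and the sharpened wild residue of
# A_∞ with SEVEN exclusions (crux `OrbitRestorationQP`, stmt-ValiantsHypothesis-18293 — line `depth-three-rung`, registered stub
# `stub_sigmaPiSigmaValue` = A_∞)

Namespace `Summit.ValiantsHypothesis.ValiantsHypothesis.Theorems.SmlAffineRestoration`.  Definition-free.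

`…AffineSubst.lean` (`AffineSubst.qpOrbitRestorable_affineSubst`) made the restorable class closed under the `Sym_n × Sym_n`-equivariant
affine changes of variables `φ(x_{ab}) = α x_{ab} + β R_a + γ C_b + δ U + ε` at cost `+6`.  Composing with the per-level affine
column- and row-set-multilinear strata (`affineColSml_restorable_uniform`, `affineRowSml_restorable_uniform`) gives per-level strata
for the `φ`-IMAGES of matrix-symmetric affine sml-easy polynomials (which are in general neither column- nor row-set-multilinear),
and hence a residue with one more pair of exclusions:

* `affineColSml_affineSubst_restorable_uniform`, `affineRowSml_affineSubst_restorable_uniform` — `∀ c ∃ c' ∀ n p`: if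
  `p = φ(q)` for some parameters `α β γ δ ε` and some MATRIX-SYMMETRIC `q` at level `n` with an affine column- (row-) sml
  expression of `≤ n^c + c` product gates, then `QPOrbitRestorable c' n p`;
* `sigmaPiSigmaValue_of_sharpResidue₇` — **A_∞ follows from restoring, with one constant per exponent, the matrix-symmetric
  `p ∈ PDClass (fun _ => 1) n c` with the six exclusions of `sigmaPiSigmaValue_of_sharpResidue₆` AND (viii)/(ix): `p` is not a
  `φ`-image of a matrix-symmetric affine column-sml-easy, resp. row-sml-easy, `q` (`≤ n^c + c` product gates).**

Honest label: bookkeeping over landed theorems (census in kernel form); no stub closed; VP ≠ VNP untouched. [folklore]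
-/

noncomputable section

open scoped Classical

-- `Summit.ValiantsHypothesis.ValiantsHypothesis.…` is the tree's single-conjunct layout (Sub = Summit).
set_option linter.dupNamespace false

namespace Summit.ValiantsHypothesis.ValiantsHypothesis.Theorems.SmlAffineRestoration

open MvPolynomial Finset Equiv Literature.Computability.AlgebraicComplexity OrbitRestorationQPDepthThreeRung DerivativeTower
  AffineSubst

/-- **φ-images of the affine COLUMN-sml stratum, per level, one constant per exponent.** [folklore] -/
theorem affineColSml_affineSubst_restorable_uniform (c : ℕ) : ∃ c' : ℕ, ∀ (n : ℕ) (p : MvPolynomial (Fin n × Fin n) ℂ),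
    (∃ (α β γ δ ε : ℂ) (q : MvPolynomial (Fin n × Fin n) ℂ),
      (∀ σ τ : Perm (Fin n), rename (fun x : Fin n × Fin n => (σ x.1, τ x.2)) q = q) ∧
      (∃ (s : ℕ) (β' : Fin s → Fin n → ℂ) (α' : Fin s → Fin n → Fin n → ℂ), s ≤ n ^ c + c ∧
        q = ∑ t : Fin s, ∏ b : Fin n, (C (β' t b) + ∑ a : Fin n, C (α' t b a) * X (a, b))) ∧
      p = aeval (fun x : Fin n × Fin n => C α * X x + C β * ∑ b : Fin n, X (x.1, b) + C γ * ∑ a : Fin n, X (a, x.2) +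
        C δ * ∑ a : Fin n, ∑ b : Fin n, X (a, b) + C ε : Fin n × Fin n → MvPolynomial (Fin n × Fin n) ℂ) q) →
    QPOrbitRestorable c' n p := by
  obtain ⟨c₁, hc₁⟩ := affineColSml_restorable_uniform c
  refine ⟨c₁ + 6, fun n p ⟨α, β, γ, δ, ε, q, hqsym, hq, hp⟩ => ?_⟩
  rw [hp]
  exact qpOrbitRestorable_affineSubst (hc₁ n q hqsym hq) α β γ δ ε

/-- **φ-images of the affine ROW-sml stratum, per level, one constant per exponent.** [folklore] -/
theorem affineRowSml_affineSubst_restorable_uniform (c : ℕ) : ∃ c' : ℕ, ∀ (n : ℕ) (p : MvPolynomial (Fin n × Fin n) ℂ),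
    (∃ (α β γ δ ε : ℂ) (q : MvPolynomial (Fin n × Fin n) ℂ),
      (∀ σ τ : Perm (Fin n), rename (fun x : Fin n × Fin n => (σ x.1, τ x.2)) q = q) ∧
      (∃ (s : ℕ) (β' : Fin s → Fin n → ℂ) (α' : Fin s → Fin n → Fin n → ℂ), s ≤ n ^ c + c ∧
        q = ∑ t : Fin s, ∏ a : Fin n, (C (β' t a) + ∑ b : Fin n, C (α' t a b) * X (a, b))) ∧
      p = aeval (fun x : Fin n × Fin n => C α * X x + C β * ∑ b : Fin n, X (x.1, b) + C γ * ∑ a : Fin n, X (a, x.2) +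
        C δ * ∑ a : Fin n, ∑ b : Fin n, X (a, b) + C ε : Fin n × Fin n → MvPolynomial (Fin n × Fin n) ℂ) q) →
    QPOrbitRestorable c' n p := by
  obtain ⟨c₁, hc₁⟩ := affineRowSml_restorable_uniform c
  refine ⟨c₁ + 6, fun n p ⟨α, β, γ, δ, ε, q, hqsym, hq, hp⟩ => ?_⟩
  rw [hp]
  exact qpOrbitRestorable_affineSubst (hc₁ n q hqsym hq) α β γ δ ε

/-- **SHARPER RESIDUE, SEVEN (PAIRS OF) EXCLUSIONS ⇒ A_∞.**  The registered stub `stub_sigmaPiSigmaValue` follows from restoring,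
with one constant per exponent `c`, the matrix-symmetric `p ∈ PDClass (fun _ => 1) n c` that have no groupable representation, are
not killed by some double-difference derivation, are not invariant under the within-row permutations of some row nor under the
within-column permutations of some column, have no affine column-sml and no affine row-sml expression with at most `n^c + c`
product gates, have some homogeneous component with a derivative space of dimension `> n^c + c`, AND are not the image under an
equivariant affine change of variables `x_{ab} ↦ α x_{ab} + β R_a + γ C_b + δ U + ε` of a matrix-symmetric polynomial with an
affine column-sml, resp. row-sml, expression of at most `n^c + c` product gates.  Conclusion = the stub's signature verbatim.
[folklore] -/
theorem sigmaPiSigmaValue_of_sharpResidue₇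
    (hW : ∀ c : ℕ, ∃ c' : ℕ, ∀ (n : ℕ) (p : MvPolynomial (Fin n × Fin n) ℂ),
      (∀ σ τ : Perm (Fin n), rename (fun q : Fin n × Fin n => (σ q.1, τ q.2)) p = p) →
      PDClass (fun _ => 1) n c p → ¬ GroupableUpTo 0 n c p →
      (∃ a a' b b' : Fin n, pderiv (a, b) p - pderiv (a', b) p - pderiv (a, b') p + pderiv (a', b') p ≠ 0) →
      (∃ (i : Fin n) (τ : Perm (Fin n)),
        rename (fun q : Fin n × Fin n => if q.1 = i then (q.1, τ q.2) else q) p ≠ p) →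
      (∃ (j : Fin n) (τ : Perm (Fin n)),
        rename (fun q : Fin n × Fin n => if q.2 = j then (τ q.1, q.2) else q) p ≠ p) →
      (¬ ∃ (s : ℕ) (β : Fin s → Fin n → ℂ) (α : Fin s → Fin n → Fin n → ℂ), s ≤ n ^ c + c ∧
        p = ∑ t : Fin s, ∏ b : Fin n, (C (β t b) + ∑ a : Fin n, C (α t b a) * X (a, b))) →
      (¬ ∃ (s : ℕ) (β : Fin s → Fin n → ℂ) (α : Fin s → Fin n → Fin n → ℂ), s ≤ n ^ c + c ∧
        p = ∑ t : Fin s, ∏ a : Fin n, (C (β t a) + ∑ b : Fin n, C (α t a b) * X (a, b))) →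
      (∃ e m : ℕ, FiniteDimensional ℂ (derivChain (homogeneousComponent e p) m) →
        n ^ c + c < Module.finrank ℂ (derivChain (homogeneousComponent e p) m)) →
      (¬ ∃ (α β γ δ ε : ℂ) (q : MvPolynomial (Fin n × Fin n) ℂ),
        (∀ σ τ : Perm (Fin n), rename (fun x : Fin n × Fin n => (σ x.1, τ x.2)) q = q) ∧
        (∃ (s : ℕ) (β' : Fin s → Fin n → ℂ) (α' : Fin s → Fin n → Fin n → ℂ), s ≤ n ^ c + c ∧
          q = ∑ t : Fin s, ∏ b : Fin n, (C (β' t b) + ∑ a : Fin n, C (α' t b a) * X (a, b))) ∧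
        p = aeval (fun x : Fin n × Fin n => C α * X x + C β * ∑ b : Fin n, X (x.1, b) + C γ * ∑ a : Fin n, X (a, x.2) +
          C δ * ∑ a : Fin n, ∑ b : Fin n, X (a, b) + C ε : Fin n × Fin n → MvPolynomial (Fin n × Fin n) ℂ) q) →
      (¬ ∃ (α β γ δ ε : ℂ) (q : MvPolynomial (Fin n × Fin n) ℂ),
        (∀ σ τ : Perm (Fin n), rename (fun x : Fin n × Fin n => (σ x.1, τ x.2)) q = q) ∧
        (∃ (s : ℕ) (β' : Fin s → Fin n → ℂ) (α' : Fin s → Fin n → Fin n → ℂ), s ≤ n ^ c + c ∧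
          q = ∑ t : Fin s, ∏ a : Fin n, (C (β' t a) + ∑ b : Fin n, C (α' t a b) * X (a, b))) ∧
        p = aeval (fun x : Fin n × Fin n => C α * X x + C β * ∑ b : Fin n, X (x.1, b) + C γ * ∑ a : Fin n, X (a, x.2) +
          C δ * ∑ a : Fin n, ∑ b : Fin n, X (a, b) + C ε : Fin n × Fin n → MvPolynomial (Fin n × Fin n) ℂ) q) →
      QPOrbitRestorable c' n p) :
    ∀ f : (n : ℕ) → MvPolynomial (Fin n × Fin n) ℂ, IsMatrixSymmetric f →
      (∃ c : ℕ, ∀ n : ℕ, PDClass (fun _ => 1) n c (f n)) →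
      ∃ c : ℕ, ∀ n : ℕ, QPOrbitRestorable c n (f n) := by
  refine sigmaPiSigmaValue_of_sharpResidue₆ fun c => ?_
  obtain ⟨c', hc'⟩ := hW c
  obtain ⟨c₁, hc₁⟩ := affineColSml_affineSubst_restorable_uniform c
  obtain ⟨c₂, hc₂⟩ := affineRowSml_affineSubst_restorable_uniform c
  refine ⟨max c' (max c₁ c₂), fun n p hsym hPD hng hD hrow hcol hC hR hcat => ?_⟩
  by_cases hφC : ∃ (α β γ δ ε : ℂ) (q : MvPolynomial (Fin n × Fin n) ℂ),
      (∀ σ τ : Perm (Fin n), rename (fun x : Fin n × Fin n => (σ x.1, τ x.2)) q = q) ∧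
      (∃ (s : ℕ) (β' : Fin s → Fin n → ℂ) (α' : Fin s → Fin n → Fin n → ℂ), s ≤ n ^ c + c ∧
        q = ∑ t : Fin s, ∏ b : Fin n, (C (β' t b) + ∑ a : Fin n, C (α' t b a) * X (a, b))) ∧
      p = aeval (fun x : Fin n × Fin n => C α * X x + C β * ∑ b : Fin n, X (x.1, b) + C γ * ∑ a : Fin n, X (a, x.2) +
        C δ * ∑ a : Fin n, ∑ b : Fin n, X (a, b) + C ε : Fin n × Fin n → MvPolynomial (Fin n × Fin n) ℂ) q
  · exact Restorable.qpOrbitRestorable_mono (le_max_of_le_right (le_max_left _ _)) (hc₁ n p hφC)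
  by_cases hφR : ∃ (α β γ δ ε : ℂ) (q : MvPolynomial (Fin n × Fin n) ℂ),
      (∀ σ τ : Perm (Fin n), rename (fun x : Fin n × Fin n => (σ x.1, τ x.2)) q = q) ∧
      (∃ (s : ℕ) (β' : Fin s → Fin n → ℂ) (α' : Fin s → Fin n → Fin n → ℂ), s ≤ n ^ c + c ∧
        q = ∑ t : Fin s, ∏ a : Fin n, (C (β' t a) + ∑ b : Fin n, C (α' t a b) * X (a, b))) ∧
      p = aeval (fun x : Fin n × Fin n => C α * X x + C β * ∑ b : Fin n, X (x.1, b) + C γ * ∑ a : Fin n, X (a, x.2) +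
        C δ * ∑ a : Fin n, ∑ b : Fin n, X (a, b) + C ε : Fin n × Fin n → MvPolynomial (Fin n × Fin n) ℂ) q
  · exact Restorable.qpOrbitRestorable_mono (le_max_of_le_right (le_max_right _ _)) (hc₂ n p hφR)
  exact Restorable.qpOrbitRestorable_mono (le_max_left _ _) (hc' n p hsym hPD hng hD hrow hcol hC hR hcat hφC hφR)

end Summit.ValiantsHypothesis.ValiantsHypothesis.Theorems.SmlAffineRestoration

end
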